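import Summits.KontsevichZagierPeriods.KontsevichZagierPeriods.Theorems.RootDecompZetaThreeFrontierRungFourPreludeP11

/-! # `RootDecompZetaThreeFrontierRungFourPreludeP12` — part 12/14 of the mechanical ≤400-line split of `pre_src.lean` (sha256 ba362a5194d75c20…)
Source: decomp-kz lens-1 g12/g13 rung-4 prelude = Prelude_v3.lean @ba362a51 (Basis22_v1 sections RotFour/Shuffle/ProdFour/GenFb/WordMoves/RungFour/Basis22 + FacetGeneric_v2 §1–§23; critic CLEARED g6 row 330 / g6-20 l.1368); --supports stmt-KontsevichZagierPeriods-27141.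
Split by census-1 g10 `gen/splitlean.py`: scopes re-opened with their `open`/`variable`/`set_option` context; mathematics and declaration order unchanged. -/

set_option linter.dupNamespace false
open MeasureTheory Set
open Literature.NumberTheory.Transcendental
set_option linter.dupNamespace false
namespace Summit.KontsevichZagierPeriods.KontsevichZagierPeriods.Cruxes.GZNormalFormWThree.GZLadder.RungFour
open Summit.KontsevichZagierPeriods.KontsevichZagierPeriods.Cruxes.GZNormalFormWThree.GZLadder.FacetFour
  (not_integrableOn_of_residue)
section RunChart
variable {M : ℕ}

/-- Auxiliary step `abs_det_MPsi`: abs det MPsi. [bookkeeping] -/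
theorem abs_det_MPsi (a b : Fin (M + 1)) : |(MPsi (M := M) a b).det| = 1 := by
  have htri : (MPsi (M := M) a b).BlockTriangular OrderDual.toDual := by
    intro i l hlt
    have hlt' : i < l := hlt
    simp only [MPsi, Matrix.of_apply]
    by_cases hi : a < i ∧ i ≤ b
    · rw [if_pos hi, if_neg (fun h => by rw [h] at hlt'; exact absurd (hi.1.trans hlt') (lt_irrefl _)),
        if_neg hlt'.ne', sub_zero]
    · rw [if_neg hi, if_neg hlt'.ne']
  rw [Matrix.det_of_lowerTriangular _ htri, Finset.abs_prod]
  refine Finset.prod_eq_one fun i _ => ?_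
  simp only [MPsi, Matrix.of_apply, if_true]
  by_cases hi : a < i ∧ i ≤ b
  · rw [if_pos hi, if_neg hi.1.ne']; simp
  · rw [if_neg hi]; simp

/-- Auxiliary step `abs_det_LR`: abs det LR. [bookkeeping] -/
theorem abs_det_LR {a b : Fin (M + 1)} {p : Fin (M + 1) → ℝ} (hp : p ∈ domR a b) :
    |((LPsi a b).comp (LSig a b p)).det| = p b ^ runInt a b := by
  have h1 : ((LPsi a b).comp (LSig a b p)).det = (MPsi (M := M) a b).det * (MSig a b p).det := by
    show LinearMap.det (((LPsi a b).comp (LSig a b p) : (Fin (M + 1) → ℝ) →L[ℝ] (Fin (M + 1) → ℝ)) :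
      (Fin (M + 1) → ℝ) →ₗ[ℝ] (Fin (M + 1) → ℝ)) = _
    rw [show (((LPsi a b).comp (LSig a b p) : (Fin (M + 1) → ℝ) →L[ℝ] (Fin (M + 1) → ℝ)) :
        (Fin (M + 1) → ℝ) →ₗ[ℝ] (Fin (M + 1) → ℝ)) =
        (LPsi a b : (Fin (M + 1) → ℝ) →ₗ[ℝ] (Fin (M + 1) → ℝ)).comp
          (LSig a b p : (Fin (M + 1) → ℝ) →ₗ[ℝ] (Fin (M + 1) → ℝ)) from rfl,
      LinearMap.det_comp, LPsi_eq_toLin', LSig_eq_toLin', LinearMap.det_toLin', LinearMap.det_toLin']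
  rw [h1, abs_mul, abs_det_MPsi, one_mul, det_MSig, abs_of_pos (pow_pos hp.2.2.1 _)]

/-- TRANSPORT through the run chart (generic k, a < b) -/
theorem integrableOn_pullR_iff {a b : Fin (M + 1)} (hab : a < b) (f : (Fin (M + 1) → ℝ) → ℝ) :
    IntegrableOn f (KZ.openOrderedSimplex (M + 1)) ↔
      IntegrableOn (fun p => f (mapR a b p) * p b ^ runInt a b) (domR a b) := by
  rw [← image_mapR hab, integrableOn_image_iff_integrableOn_abs_det_fderiv_smul (μ := volume)
    (isOpen_domR a b).measurableSet (fun x _ => (hasFDerivAt_mapR a b x).hasFDerivWithinAt) (injOn_mapR hab) f]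
  exact integrableOn_congr_fun (fun p hp => by rw [abs_det_LR hp, smul_eq_mul, mul_comm]) (isOpen_domR a b).measurableSet

end RunChart

/-! ## §20 GENERIC RUN FACETS `{t_a, …, t_b}` (any `k = M+1`, `a < b`): the residue of an integrable frame
combination along `ε = p_b → 0` in the run chart `R_{a,b}` vanishes on the open facet region `baseR a b`.
With §18 (tails), §7 (reflection) and this section, EVERY facet of EVERY `Δ_k` is covered by a generic theorem. -/

section RunFacet
variable {M : ℕ}
set_option linter.unusedSimpArgs false

/-- the top point `t_a = x_a` of the collapsed run, read off the base point -/
def topR (a : Fin (M + 1)) (x : Fin M → ℝ) : ℝ := if h : (a : ℕ) < M then x ⟨a, h⟩ else 1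

/-- the next point below the run (`x_b = p_{b+1}`), or `0` -/
def lowB (b : Fin (M + 1)) (x : Fin M → ℝ) : ℝ := if h : (b : ℕ) < M then x ⟨b, h⟩ else 0

/-- the section bound for `ε`: `t_b = t_a − ε` must stay above the next point -/
def epsMax (a b : Fin (M + 1)) (x : Fin M → ℝ) : ℝ := topR a x - lowB b x

/-- Auxiliary step `topR_eq` (§20): top R eq. [bookkeeping] -/
theorem topR_eq {a b : Fin (M + 1)} (hab : (a : ℕ) < b) (x : Fin M → ℝ) : topR a x = x ⟨a, by omega⟩ := by
  unfold topR; rw [dif_pos (by omega)]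

/-- the open facet region: head `x_0 > … > x_a` in (0,1), shapes `x_{a+1} < … < x_{b-1}` in (0,1), tail
`x_b > … > x_{M-1} > 0` with `x_b < x_a` -/
def baseR (a b : Fin (M + 1)) : Set (Fin M → ℝ) :=
  {x | (∀ i : Fin M, (i : ℕ) ≤ a → 0 < x i ∧ x i < 1) ∧ (∀ i i' : Fin M, i < i' → (i' : ℕ) ≤ a → x i' < x i) ∧
    (∀ i : Fin M, (a : ℕ) < i → (i : ℕ) < b → 0 < x i ∧ x i < 1) ∧
    (∀ i i' : Fin M, (a : ℕ) < i → i < i' → (i' : ℕ) < b → x i < x i') ∧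
    (∀ i : Fin M, (b : ℕ) ≤ i → 0 < x i) ∧ (∀ i i' : Fin M, (b : ℕ) ≤ i → i < i' → x i' < x i) ∧
    lowB b x < topR a x}

/-- Auxiliary step `topR_mem` (§20): top R mem. [bookkeeping] -/
theorem topR_mem {a b : Fin (M + 1)} (hab : (a : ℕ) < b) {x : Fin M → ℝ} (hx : x ∈ baseR a b) :
    0 < topR a x ∧ topR a x < 1 := by
  rw [topR_eq hab]; exact hx.1 _ (by simp)

/-- Auxiliary step `lowB_nonneg` (§20): low B nonneg. [bookkeeping] -/
theorem lowB_nonneg {a b : Fin (M + 1)} {x : Fin M → ℝ} (hx : x ∈ baseR a b) : 0 ≤ lowB b x := by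
  unfold lowB; split_ifs with h
  · exact (hx.2.2.2.2.1 _ (by simp)).le
  · exact le_rfl

/-- Auxiliary step `tail_le_lowB` (§20): tail le low B. [bookkeeping] -/
theorem tail_le_lowB {a b : Fin (M + 1)} {x : Fin M → ℝ} (hx : x ∈ baseR a b) (i : Fin M) (hi : (b : ℕ) ≤ i) :
    x i ≤ lowB b x := by
  unfold lowB
  rw [dif_pos (by omega)]
  rcases (show (b : ℕ) = i ∨ (b : ℕ) < i by omega) with h | h
  · have : (⟨(b : ℕ), by omega⟩ : Fin M) = i := Fin.ext (by simpa using h)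
    rw [this]
  · exact (hx.2.2.2.2.2.1 ⟨(b : ℕ), by omega⟩ i (by simp) (Fin.lt_def.2 (by simpa using h))).le

/-- Auxiliary step `epsMax_pos` (§20): eps Max pos. [bookkeeping] -/
theorem epsMax_pos {a b : Fin (M + 1)} {x : Fin M → ℝ} (hx : x ∈ baseR a b) : 0 < epsMax a b x :=
  sub_pos.2 hx.2.2.2.2.2.2

/-- Auxiliary step `epsMax_lt_one` (§20): eps Max lt one. [bookkeeping] -/
theorem epsMax_lt_one {a b : Fin (M + 1)} (hab : (a : ℕ) < b) {x : Fin M → ℝ} (hx : x ∈ baseR a b) :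
    epsMax a b x < 1 := by
  unfold epsMax; linarith [(topR_mem hab hx).2, lowB_nonneg hx]

/-- Auxiliary step `continuous_topR` (§20): continuous top R. [bookkeeping] -/
theorem continuous_topR (a : Fin (M + 1)) : Continuous (topR (M := M) a) := by
  unfold topR; split_ifs <;> fun_prop

/-- Auxiliary step `continuous_lowB` (§20): continuous low B. [bookkeeping] -/
theorem continuous_lowB (b : Fin (M + 1)) : Continuous (lowB (M := M) b) := by
  unfold lowB; split_ifs <;> fun_prop

/-- Auxiliary step `continuous_epsMax` (§20): continuous eps Max. [bookkeeping] -/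
theorem continuous_epsMax (a b : Fin (M + 1)) : Continuous (epsMax (M := M) a b) :=
  (continuous_topR a).sub (continuous_lowB b)

/-- Auxiliary step `lowR_insR` (§20): low R ins R. [bookkeeping] -/
theorem lowR_insR (b : Fin (M + 1)) (ε : ℝ) (x : Fin M → ℝ) :
    lowR b (Fin.insertNth b ε x : Fin (M + 1) → ℝ) = lowB b x := by
  unfold lowR lowB
  split_ifs with h
  · rw [insT_gt b ε x _ (Fin.lt_def.2 (by simp))]
    exact congrArg x (Fin.ext (by simp only [Fin.val_mk]; omega))
  · rfl

/-- Auxiliary step `isOpen_baseR` (§20): is Open base R. [bookkeeping] -/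
theorem isOpen_baseR (a b : Fin (M + 1)) : IsOpen (baseR (M := M) a b) := by
  have hc : ∀ i : Fin M, Continuous fun x : Fin M → ℝ => x i := fun i => continuous_apply i
  have e : baseR (M := M) a b =
      (⋂ i : Fin M, {x : Fin M → ℝ | (i : ℕ) ≤ a → (0:ℝ) < x i} ∩ {x | (i : ℕ) ≤ a → x i < 1}) ∩
      (⋂ i : Fin M, ⋂ i' : Fin M, {x : Fin M → ℝ | i < i' → (i' : ℕ) ≤ a → x i' < x i}) ∩
      (⋂ i : Fin M, {x : Fin M → ℝ | (a : ℕ) < i → (i : ℕ) < b → (0:ℝ) < x i} ∩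
        {x | (a : ℕ) < i → (i : ℕ) < b → x i < 1}) ∩
      (⋂ i : Fin M, ⋂ i' : Fin M, {x : Fin M → ℝ | (a : ℕ) < i → i < i' → (i' : ℕ) < b → x i < x i'}) ∩
      (⋂ i : Fin M, {x : Fin M → ℝ | (b : ℕ) ≤ i → (0:ℝ) < x i}) ∩
      (⋂ i : Fin M, ⋂ i' : Fin M, {x : Fin M → ℝ | (b : ℕ) ≤ i → i < i' → x i' < x i}) ∩
      {x | lowB b x < topR a x} := by
    ext x
    simp only [baseR, Set.mem_setOf_eq, Set.mem_inter_iff, Set.mem_iInter]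
    constructor
    · rintro ⟨h1, h2, h4, h5, h6, h7, h8⟩
      exact ⟨⟨⟨⟨⟨⟨fun i => ⟨fun hi => (h1 i hi).1, fun hi => (h1 i hi).2⟩, h2⟩,
        fun i => ⟨fun hi hi' => (h4 i hi hi').1, fun hi hi' => (h4 i hi hi').2⟩⟩, h5⟩, h6⟩, h7⟩, h8⟩
    · rintro ⟨⟨⟨⟨⟨⟨h1, h2⟩, h4⟩, h5⟩, h6⟩, h7⟩, h8⟩
      exact ⟨fun i hi => ⟨(h1 i).1 hi, (h1 i).2 hi⟩, h2, fun i hi hi' => ⟨(h4 i).1 hi hi', (h4 i).2 hi hi'⟩,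
        h5, h6, h7, h8⟩
  rw [e]
  refine IsOpen.inter (IsOpen.inter (IsOpen.inter (IsOpen.inter (IsOpen.inter (IsOpen.inter
    (isOpen_iInter_of_finite fun i => (isOpen_imp_lt _ continuous_const (hc i)).inter
      (isOpen_imp_lt _ (hc i) continuous_const))
    (isOpen_iInter_of_finite fun i => isOpen_iInter_of_finite fun i' => isOpen_imp_imp_lt _ _ (hc i') (hc i)))
    (isOpen_iInter_of_finite fun i => (isOpen_imp_imp_lt _ _ continuous_const (hc i)).inter
      (isOpen_imp_imp_lt _ _ (hc i) continuous_const)))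
    (isOpen_iInter_of_finite fun i => isOpen_iInter_of_finite fun i' => isOpen_imp3_lt _ _ _ (hc i) (hc i')))
    (isOpen_iInter_of_finite fun i => isOpen_imp_lt _ continuous_const (hc i)))
    (isOpen_iInter_of_finite fun i => isOpen_iInter_of_finite fun i' => isOpen_imp_imp_lt _ _ (hc i') (hc i)))
    (isOpen_lt (continuous_lowB b) (continuous_topR a))

/-- SECTION: `x ∈ baseR`, `0 < ε < epsMax` ⟹ `insertNth b ε x ∈ domR a b` -/
theorem insR_mem_domR {a b : Fin (M + 1)} (hab : a < b) {x : Fin M → ℝ} (hx : x ∈ baseR a b) {ε : ℝ}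
    (hε0 : 0 < ε) (hε1 : ε < epsMax a b x) : (Fin.insertNth b ε x : Fin (M + 1) → ℝ) ∈ domR a b := by
  have hab' : (a : ℕ) < b := hab
  have hb := b.isLt
  have htop := topR_eq hab' x
  obtain ⟨hh, hhd, hs, hsi, htp, htd, hl⟩ := hx
  refine ⟨fun i hi => ?_, fun i i' hlt hi' => ?_, ?_, fun i hi1 hi2 => ?_, fun i i' hi hlt hi' => ?_,
    fun i hi => ?_, fun i i' hi hlt => ?_, ?_⟩
  · rw [insT_lt b ε x i (lt_of_le_of_lt hi hab)]; exact hh _ (by simpa using hi)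
  · rw [insT_lt b ε x i' (lt_of_le_of_lt hi' hab), insT_lt b ε x i (lt_of_le_of_lt (hlt.le.trans hi') hab)]
    have h1 : (i : ℕ) < i' := hlt
    have h2 : (i' : ℕ) ≤ a := hi'
    exact hhd _ _ (Fin.mk_lt_mk.2 h1) h2
  · rw [insT_self]; exact hε0
  · rw [insT_lt b ε x i hi2]
    have h1 : (a : ℕ) < i := hi1
    have h2 : (i : ℕ) < b := hi2
    exact hs _ h1 h2
  · rw [insT_lt b ε x i (hlt.trans hi'), insT_lt b ε x i' hi']
    have h1 : (a : ℕ) < i := hi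
    have h2 : (i : ℕ) < i' := hlt
    have h3 : (i' : ℕ) < b := hi'
    exact hsi _ _ h1 (Fin.mk_lt_mk.2 h2) h3
  · rw [insT_gt b ε x i hi]
    have h1 : (b : ℕ) < i := hi
    exact htp _ (by simp only [Fin.val_mk]; omega)
  · rw [insT_gt b ε x i hi, insT_gt b ε x i' (hi.trans hlt)]
    have h1 : (b : ℕ) < i := hi
    have h2 : (i : ℕ) < i' := hlt
    exact htd _ _ (by simp only [Fin.val_mk]; omega) (Fin.mk_lt_mk.2 (by omega))
  · rw [lowR_insR, insT_self, insT_lt b ε x a hab]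
    have : lowB b x < topR a x - ε := by unfold epsMax at hε1; linarith
    rw [htop] at this
    exact this

/-- VALUE TABLE of the labelled points at `R_{a,b} (insertNth b ε x)` -/
theorem xpt_mapR_insR {a b : Fin (M + 1)} (hab : (a : ℕ) < b) (ε : ℝ) (x : Fin M → ℝ) (l : Fin (M + 3)) :
    xpt (M + 1) (mapR a b (Fin.insertNth b ε x)) l =
      if h0 : (l : ℕ) = 0 then 1
      else if h1 : (l : ℕ) ≤ a + 1 then x ⟨(l : ℕ) - 1, by omega⟩
      else if h2 : (l : ℕ) ≤ b then topR a x - ε * x ⟨(l : ℕ) - 1, by omega⟩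
      else if h3 : (l : ℕ) = b + 1 then topR a x - ε
      else if h4 : (l : ℕ) ≤ M + 1 then x ⟨(l : ℕ) - 2, by omega⟩
      else 0 := by
  have hb := b.isLt
  have habF : a < b := hab
  have htop := topR_eq hab x
  unfold xpt
  by_cases h0 : (l : ℕ) = 0
  · simp [h0]
  rw [dif_neg h0, dif_neg h0]
  by_cases hl : (l : ℕ) ≤ M + 1
  · rw [dif_pos hl]
    by_cases h1 : (l : ℕ) ≤ a + 1
    · rw [dif_pos h1]
      have hle : (⟨(l : ℕ) - 1, by omega⟩ : Fin (M + 1)) ≤ a := Fin.le_def.2 (by simp only [Fin.val_mk]; omega)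
      rw [mapR_apply_out (Or.inl hle), insT_lt b ε x _ (lt_of_le_of_lt hle habF)]
    rw [dif_neg h1]
    by_cases h2 : (l : ℕ) ≤ b
    · rw [dif_pos h2]
      have hgt : a < (⟨(l : ℕ) - 1, by omega⟩ : Fin (M + 1)) := Fin.lt_def.2 (by simp only [Fin.val_mk]; omega)
      have hlt : (⟨(l : ℕ) - 1, by omega⟩ : Fin (M + 1)) < b := Fin.lt_def.2 (by simp only [Fin.val_mk]; omega)
      rw [mapR_apply_int hgt hlt, insT_self, insT_lt b ε x a habF, insT_lt b ε x _ hlt, htop]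
    rw [dif_neg h2]
    by_cases h3 : (l : ℕ) = b + 1
    · rw [dif_pos h3]
      have he : (⟨(l : ℕ) - 1, by omega⟩ : Fin (M + 1)) = b := Fin.ext (by simp only [Fin.val_mk]; omega)
      rw [he, mapR_apply_bot habF, insT_self, insT_lt b ε x a habF, htop]
    · rw [dif_neg h3, dif_pos hl]
      have hgt : b < (⟨(l : ℕ) - 1, by omega⟩ : Fin (M + 1)) := Fin.lt_def.2 (by simp only [Fin.val_mk]; omega)
      rw [mapR_apply_out (Or.inr hgt), insT_gt b ε x _ hgt]
      exact congrArg x (Fin.ext (by simp only [Fin.val_mk]; omega))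
  · rw [dif_neg hl, dif_neg (by omega), dif_neg (by omega), dif_neg (by omega), dif_neg hl]

/-- the shape value of a run label `a+1 ≤ l ≤ b+1`: `0` at the top, `x_{l-1}` inside, `1` at the bottom -/
def slab (a b : Fin (M + 1)) (x : Fin M → ℝ) (l : Fin (M + 3)) : ℝ :=
  if (l : ℕ) = a + 1 then 0 else if h : (l : ℕ) ≤ b ∧ (a : ℕ) + 1 < l then x ⟨(l : ℕ) - 1, by omega⟩ else 1

/-- Auxiliary step `xpt_mapR_insR_of_cluster` (§20): xpt map R ins R of cluster. [bookkeeping] -/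
theorem xpt_mapR_insR_of_cluster {a b : Fin (M + 1)} (hab : (a : ℕ) < b) (ε : ℝ) (x : Fin M → ℝ)
    (l : Fin (M + 3)) (hl1 : (a : ℕ) + 1 ≤ l) (hl2 : (l : ℕ) ≤ b + 1) :
    xpt (M + 1) (mapR a b (Fin.insertNth b ε x)) l = topR a x - ε * slab a b x l := by
  rw [xpt_mapR_insR hab]
  unfold slab
  rw [dif_neg (by omega)]
  by_cases h1 : (l : ℕ) = a + 1
  · rw [dif_pos (by omega), if_pos h1, mul_zero, sub_zero, topR_eq hab]
    exact congrArg x (Fin.ext (by simp only [Fin.val_mk]; omega))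
  rw [dif_neg (by omega), if_neg h1]
  by_cases h2 : (l : ℕ) ≤ b
  · rw [dif_pos h2, dif_pos ⟨h2, by omega⟩]
  · rw [dif_neg h2, dif_pos (by omega), dif_neg (by omega), mul_one]

/-- Auxiliary step `slab_nonneg` (§20): slab nonneg. [bookkeeping] -/
theorem slab_nonneg {a b : Fin (M + 1)} {x : Fin M → ℝ} (hx : x ∈ baseR a b) (l : Fin (M + 3)) : 0 ≤ slab a b x l := by
  unfold slab; split_ifs with h1 h2
  · exact le_rfl
  · exact (hx.2.2.1 _ (by simp only [Fin.val_mk]; omega) (by simp only [Fin.val_mk]; omega)).1.le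
  · exact zero_le_one

/-- Auxiliary step `slab_le_one` (§20): slab le one. [bookkeeping] -/
theorem slab_le_one {a b : Fin (M + 1)} {x : Fin M → ℝ} (hx : x ∈ baseR a b) (l : Fin (M + 3)) : slab a b x l ≤ 1 := by
  unfold slab; split_ifs with h1 h2
  · exact zero_le_one
  · exact (hx.2.2.1 _ (by simp only [Fin.val_mk]; omega) (by simp only [Fin.val_mk]; omega)).2.le
  · exact le_rfl

/-- the REDUCED forms at `(x, ε)` -/
noncomputable def redR (a b : Fin (M + 1)) (c : Chord (M + 1)) (z : (Fin M → ℝ) × ℝ) : ℝ :=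
  if (a : ℕ) + 1 ≤ c.i ∧ (c.j : ℕ) ≤ b + 1 then slab a b z.1 c.j - slab a b z.1 c.i
  else c.form (mapR a b (Fin.insertNth b z.2 z.1))

/-- Auxiliary step `form_mapR_insR` (§20): form map R ins R. [bookkeeping] -/
theorem form_mapR_insR {a b : Fin (M + 1)} (hab : (a : ℕ) < b) (c : Chord (M + 1)) (x : Fin M → ℝ) (ε : ℝ) :
    c.form (mapR a b (Fin.insertNth b ε x)) =
      (if (a : ℕ) + 1 ≤ c.i ∧ (c.j : ℕ) ≤ b + 1 then ε else 1) * redR a b c (x, ε) := by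
  unfold redR
  by_cases h : (a : ℕ) + 1 ≤ c.i ∧ (c.j : ℕ) ≤ b + 1
  · rw [if_pos h, if_pos h]
    have hlt : (c.i : ℕ) < c.j := c.lt
    simp only [Chord.form]
    rw [xpt_mapR_insR_of_cluster hab ε x c.i h.1 (by omega), xpt_mapR_insR_of_cluster hab ε x c.j (by omega) h.2]
    ring
  · rw [if_neg h, if_neg h, one_mul]

end RunFacet
end Summit.KontsevichZagierPeriods.KontsevichZagierPeriods.Cruxes.GZNormalFormWThree.GZLadder.RungFour
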